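import Literature.MathematicalPhysics.QuantumFieldTheory.Balaban1983to89.B5Eq165DeltaK
import Literature.MathematicalPhysics.QuantumFieldTheory.Balaban1983to89.B5Eq147FromEq123
import Literature.MathematicalPhysics.QuantumFieldTheory.Balaban1983to89.B5TowerOneStroke
import Literature.MathematicalPhysics.QuantumFieldTheory.Balaban1983to89.B5Identities197Torus

/-!
# `Balaban1983to89.B5HkOpLandauMin` — T. Bałaban, *Propagators and renormalization transformations for lattice gauge
# theories. I*, Commun. Math. Phys. **95** (1984) 17–40 [Balaban1984PropagatorsI], pp. 24–29: **the Landau gauge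
# condition `R∂*A = 0` of the (1.17) tower IS the tree's `(I − P)∂*Ã = 0`, and the closed-form operator `H_k` of
# (1.63) IS the Landau-gauge minimiser `H_kB`** («This defines the operator H_kB = A», p. 28; «we can verify all the
# properties of H_kB», p. 29) — PROVED on the typed tower of `B5SectBStatements`

statement-level skeleton of published theorems with citation tags; proofs where landed; nothing here is a claim about the Yang–Mills mass gap

PDF held: `paper:balaban1984-cmp95-propagators-rt-i` (journal page = PDF page + 16); pages read AS IMAGES by this seat:
renders `…/1984-cmp95-propagators-rt-I/…-p008-x2.png` (p. 24: (1.38)), `…-p009-x2.png` (p. 25: «The projection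
operator R has a clear meaning. It is an orthogonal projection on the linear subspace ΔN(Q′_k) of L²(T_η), N(Q′_k) =
{λ : Q′_kλ = 0}.»), `…-p010-x2.png` (p. 26: «minimizing … under the conditions Q_kA = B, R∂*A = 0»), `…-p012-x2.png`
(p. 28: (1.60)–(1.63), «This defines the operator H_kB = A»), `…-p013-x2.png` (p. 29: «Using (1.60), or better (1.63), we
can verify all the properties of H_kB: Q_kH_kB = B, R∂*H_kB = 0, H_kB is a minimum of ½⟨∂A, ∂A⟩ on the hyperplane
{A : Q_kA = B, R∂*A = 0}, which means that ⟨∂A′, ∂H_kB⟩ = 0 on the subspace {A′ : Q_kA′ = 0, R∂*A′ = 0}.», (1.64)–(1.65),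
(1.69) «R = I − P»).

CITATION HEADER (lean-in-tree rule).  Cell `lit-balaban` (HOME `run/shared/lean/pub/lit-balaban/`), unit `lit-balaban-p16`
gen 2 (Phase-2 proof seat p16; `literature-prover-lit-balaban-p16-g2-0`), file 4; WHAT IS REPRODUCED = SKELETON row
**B5.Claim@29** (p. 29, the H_k-properties sentence; typed `B5.HkPropsPrinted`, proved for the one-stroke torus data by
`B5HkPropsTorus`) in the CURRENCY OF THE (1.17) TOWER (`B5SectBStatements.towerM/Qk/Qsk/actionEta`, owner r02), and the
knitting left open by this seat's files 1–3 (`B5Eq147Landau` p248304, `B5Eq165DeltaK` p248486, `B5Eq147FromEq123`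
p248692) with seat p21's `B5TowerOneStroke` (p248294): two typings of `R` and two typings of `H_k` are identified.

WHAT IS PROVED (zero `sorry`; every `d`, `L ≥ 1`, torus `M`, level `k`, unless `2 ≤ d` is stated).
* §1–§2  Transport across the site identification `towerE k : Tor (towerM L M k) ≃ Tor (fine (L^k) M)`: the real
  divergence `Dv` and Laplacian `Lap` of `B5Eq147Landau` read on `T_η` are the tree's `divS`/`LapS` at `c = L^k`
  (`divS_towerE`, `LapS_towerE`), `N(Q′_k)` corresponds (`QsOp_trS_eq_zero_iff`), and the real pairing `⟨∂*A, Δλ⟩` is the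
  Hermitian dot product on `T_η` (`inner_Dv_Lap_eq`).
* §3–§4  **DICTIONARY OF THE TWO `R`'s**: `B5Eq147Landau.Lan k` — defined with `R :=` the orthogonal projection onto
  `ΔN(Q′_k)` (the p. 25 sentence) — is EXACTLY the tree's gauge condition `(1 − PcT (L^k) M)·∂*Ã = 0` with the formula
  `P` of (1.38)/(1.70) (`B5Value126.PcT`) and `Ã = trC (towerE k) (cplx A)` (`mem_Lan_iff_oneSubPcT`; via the p. 25
  projection `B5Identities197Torus.RT` and its fixed-space theorem `RT_mulVec_eq_self_iff`: `mem_Lan_iff_RT`).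
* §5  **`H_k` OF (1.63) = THE LANDAU MINIMISER**: `hkT k B := pullR k (HkOp (L^k) M ·cplx B)` (seat p21's transport of
  `B5Hk163Torus.HkOp`) lies in `Lan k` (`hkT_mem_Lan`, from `B5Hk163RDiv.R_divS_HkOp'` = «R∂*H_kB = 0»), in the fibre
  `{Q_kA = B}` and minimises `S^η_k` there (p21), hence `hkT k B ∈ landauMin k B` (`hkT_mem_landauMin`, every `d`) and for
  `d ≥ 2` **`landauMin k B = {hkT k B}`** (`landauMin_eq_singleton`, by `B5Eq165DeltaK.landauMin_subsingleton`): the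
  variational definition of p. 26/p. 28 and the closed form (1.63) define the same field.  Consequences with the tree's
  `H_k` verbatim: `S1 M (DeltaK k) B = S^η(hkT k B)` (½⟨B,Δ_kB⟩ for the Δ_k of (1.19)), (1.65) `eq165_hkT`, (1.64)
  `eq164_hkT`, the «which means» clause `inner_Tk_hkT_eq_zero`.
* §6  **ROW B5.Claim@29 ON THE TOWER**: `hkPropsPrinted_tower : B5.HkPropsPrinted (hkDataTower L M k)` for the data
  `(Fld (towerM k), Fld M, Q_k, (· ∈ Lan k), S^η_k, hkT k)` — every `d` —, and «the printed properties determine H_k» on the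
  tower for `d ≥ 2` (`eq_hkT_of_hkPropsPrinted`, `hkPropsPrinted_tower_iff`).

HONEST SCOPE.  (i) Torus tower `towerM L M k`, `U = 1`, abelian-linearised fields (the paper's Sect. 1 setting), exactly
as in `B5SectBStatements`; (ii) `R` on the tower is `B5Eq147Landau.Rproj` (orthogonal projection onto `ΔN(Q′_k)`); the
identification with `I − P` of (1.38) is §4 here, the identification `RT = I − P − P_const` is `B5Identities197Torus`;
(iii) the identity `S1 M (DeltaK k) B = ½·formDk (L^k) M (cplx B)` (IF2-25 meet) and the operator identity
`cplx (DeltaK k B) = DelK (L^k) … ·cplx B` are seat p21 gen 4's `B5Eq166GaussDeltaK` (p249024) and are NOT restated here —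
§5 gives the `S^η(hkT k B)` form only (p21's `S1_DeltaK_eq_actionEta_pullR_HkOp` is the same number by a different
road: IsLeast.unique there, `landauMin` membership here); (iv) value = DAG edges
«statement ⇐ lemmas» between landed modules; NOT summit progress.

Unit `lit-balaban-p16` gen 2, HOME `run/shared/lean/pub/lit-balaban/` (STATUS: `lit-balaban-p16/STATUS.md`),
2026-08-21.  Owner r02, referee ref-4.
-/

open scoped BigOperators InnerProductSpace Matrix ComplexConjugate ComplexOrder

namespace Literature.MathematicalPhysics.QuantumFieldTheory.Balaban1983to89.B5HkOpLandauMin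

open B5SectBStatements B5Eq114Gauss B5Eq147Landau B5Eq165DeltaK
open B5Eq147FromEq123 (Dv_eq_dvR Lap_eq_LapR)
open B5TowerOneStroke (towerE towerE_eq towerM_eq_fine trC trS trC_apply trS_apply trS_apply' pullR reC reC_apply
  trC_cplx_pullR Qk_pullR_HkOp actionEta_pullR_HkOp half_formDk_le_actionEta cplxS_Qsk recast_unitVec)
open B5Prop11Plancherel (Tor fine unitVec)
open B5Composition116 (recast recast_add)
open B5Block118 (QsOp QsOp_mulVec bpt)
open B5Action121 (divS divS_apply LapS LapS_mulVec GradOp GradOp_conjTranspose_mulVec_eq)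
open B5Value126 (PcT)
open B5Identities197Torus (RT RT_conjTranspose RT_mul_GradOp_adjoint RT_mulVec_LapS_of_ker RT_mulVec_eq_LapS)
open B5Hk163Torus (HkOp)
open B5Hk163RDiv (R_divS_HkOp')
open B5Bounds167Lattice (formDk)
open B5 (HkData HkPropsPrinted)
open Matrix

noncomputable section

variable {d : ℕ}

/-! ## §1  Transport of `∂*`, `Δ` and of the pairing across a site identification `recast` -/

section Transport

variable {N N' : Fin d → ℕ}

/-- `recast (x − y) = recast x − recast y`. [cite: Balaban1984PropagatorsI, (1.18) p.20] -/
theorem recast_sub (h : ∀ ν, N ν = N' ν) (x y : Tor N) : recast h (x - y) = recast h x - recast h y := by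
  rw [eq_sub_iff_add_eq, ← recast_add, sub_add_cancel]

variable [hN : ∀ μ, NeZero (N μ)] [hN' : ∀ μ, NeZero (N' μ)]

/-- the divergence (1.21) is natural under `recast`: `(∂* trC A)(recast x) = (∂*A)(x)`.
[cite: Balaban1984PropagatorsI, (1.21) p.21] -/
theorem divS_trC (h : ∀ ν, N ν = N' ν) (c : ℂ) (A : Tor N × Fin d → ℂ) (x : Tor N) :
    divS N' c (trC (recast h) A) (recast h x) = divS N c A x := by
  simp only [divS_apply, ← recast_unitVec h, ← recast_sub, trC_apply]

/-- the Laplacian `Δ = ∂*∂` (1.21) is natural under `recast`: `(Δ trS λ)(recast x) = (Δλ)(x)`.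
[cite: Balaban1984PropagatorsI, (1.21) p.21] -/
theorem LapS_trS (h : ∀ ν, N ν = N' ν) (c : ℂ) (l : Tor N → ℂ) (x : Tor N) :
    (LapS N' c *ᵥ trS (recast h) l) (recast h x) = (LapS N c *ᵥ l) x := by
  simp only [LapS_mulVec, ← recast_unitVec h, ← recast_add, ← recast_sub, trS_apply]

/-- the Hermitian pairing of `L²(T_η)` is natural under a site identification. [cite: Balaban1984PropagatorsI, (1.21) p.21] -/
theorem star_trS_dotProduct_trS (e : Tor N ≃ Tor N') (v w : Tor N → ℂ) :
    star (trS e v) ⬝ᵥ trS e w = star v ⬝ᵥ w := by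
  simp only [dotProduct, Pi.star_apply, trS_apply']
  exact Fintype.sum_equiv e.symm _ _ fun x => rfl

omit hN in
/-- pairing a REAL scalar function with the real part of a complex one: `⟨λ, Re g⟩ = Re⟨λ, g⟩`.
[cite: Balaban1984PropagatorsI, (1.21) p.21] -/
theorem star_trS_cplxS_dotProduct_reC (e : Tor N ≃ Tor N') (r : Scl N) (g : Tor N' → ℂ) :
    star (trS e (cplxS r)) ⬝ᵥ reC g = (((star (trS e (cplxS r)) ⬝ᵥ g).re : ℝ) : ℂ) := by
  simp only [dotProduct, Pi.star_apply, trS_apply', cplxS, Complex.star_def, Complex.conj_ofReal, reC_apply,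
    Complex.re_sum, Complex.re_ofReal_mul, Complex.ofReal_sum, Complex.ofReal_mul]

/-- the Hermitian pairing of two REAL scalar functions is their real `ℓ²` inner product.
[cite: Balaban1984PropagatorsI, (1.21) p.21] -/
theorem star_cplxS_dotProduct_cplxS (v w : Scl N) : star (cplxS v) ⬝ᵥ cplxS w = ((⟪v, w⟫_ℝ : ℝ) : ℂ) := by
  simp only [dotProduct, Pi.star_apply, cplxS, Complex.star_def, Complex.conj_ofReal, PiLp.inner_apply,
    RCLike.inner_apply, conj_trivial, Complex.ofReal_sum, Complex.ofReal_mul, mul_comm]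

omit hN' in
/-- the divergence has REAL coefficients: `∂*(Re X) = Re(∂*X)` (lattice factor `c = n`).
[cite: Balaban1984PropagatorsI, (1.21) p.21] -/
theorem divS_reC (n : ℕ) (X : Tor N × Fin d → ℂ) : divS N (n : ℂ) (reC X) = reC (divS N (n : ℂ) X) := by
  funext x
  rw [reC_apply, divS_apply, divS_apply, map_natCast, Complex.re_sum, Complex.ofReal_sum]
  refine Finset.sum_congr rfl fun μ _ => ?_
  rw [← Complex.ofReal_natCast, Complex.re_ofReal_mul, reC_apply, reC_apply, Complex.sub_re, Complex.ofReal_mul,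
    Complex.ofReal_sub]

/-- the imaginary part of a complex field, as a complex field (companion of `B5TowerOneStroke.reC`).
[cite: Balaban1984PropagatorsI, (1.1) p.18] -/
def imC {ι : Type*} (f : ι → ℂ) : ι → ℂ := fun i => (((f i).im : ℝ) : ℂ)

/-- `imC` acts pointwise. [cite: Balaban1984PropagatorsI, (1.1) p.18] -/
theorem imC_apply {ι : Type*} (f : ι → ℂ) (i : ι) : imC f i = (((f i).im : ℝ) : ℂ) := rfl

/-- `f = Re f + i·Im f`. [cite: Balaban1984PropagatorsI, (1.1) p.18] -/
theorem reC_add_imC {ι : Type*} (f : ι → ℂ) : reC f + Complex.I • imC f = f := by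
  funext i
  simp only [Pi.add_apply, Pi.smul_apply, smul_eq_mul, reC_apply, imC_apply]
  rw [mul_comm]
  exact Complex.re_add_im (f i)

end Transport

/-! ## §2  The tower objects of `B5Eq147Landau` read on the one-stroke torus `T_η = fine (L^k) M` -/

variable (L : ℕ) (M : Fin d → ℕ) [NeZero L] [hM : ∀ μ, NeZero (M μ)]

/-- the scalar average `Q′_k` has REAL coefficients: `Q′_k(Re f) = Re(Q′_k f)`. [cite: Balaban1984PropagatorsI, (1.20) p.20] -/
theorem QsOp_mulVec_reC (n : ℕ) [NeZero n] (f : Tor (fine n M) → ℂ) :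
    QsOp n M *ᵥ reC f = reC (QsOp n M *ᵥ f) := by
  funext y
  rw [reC_apply, QsOp_mulVec, QsOp_mulVec]
  have hc : (1 / (n : ℂ) ^ d) = (((1 / (n : ℝ) ^ d : ℝ)) : ℂ) := by
    push_cast
    ring
  rw [hc, Complex.re_ofReal_mul, Complex.ofReal_mul]
  congr 1
  simp only [reC_apply, Complex.re_sum, Complex.ofReal_sum]

/-- `Q′_k(Im f) = Im(Q′_k f)`. [cite: Balaban1984PropagatorsI, (1.20) p.20] -/
theorem QsOp_mulVec_imC (n : ℕ) [NeZero n] (f : Tor (fine n M) → ℂ) :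
    QsOp n M *ᵥ imC f = imC (QsOp n M *ᵥ f) := by
  funext y
  rw [imC_apply, QsOp_mulVec, QsOp_mulVec]
  have hc : (1 / (n : ℂ) ^ d) = (((1 / (n : ℝ) ^ d : ℝ)) : ℂ) := by
    push_cast
    ring
  rw [hc, Complex.im_ofReal_mul, Complex.ofReal_mul]
  congr 1
  simp only [imC_apply, Complex.im_sum, Complex.ofReal_sum]

/-- **`∂*` = `∂*`**: the real divergence `Dv k A` of the tower field, read on `T_η`, is the tree's `∂*Ã` at lattice
factor `η⁻¹ = L^k`, `Ã = trC (towerE k) (cplx A)`. [cite: Balaban1984PropagatorsI, (1.21) p.21, (1.17)–(1.18) p.20] -/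
theorem divS_towerE (k : ℕ) (A : Fld (towerM L M k)) :
    divS (fine (L ^ k) M) ((L ^ k : ℕ) : ℂ) (trC (towerE L M k) (cplx A)) = trS (towerE L M k) (cplxS (Dv L M k A)) := by
  funext x'
  obtain ⟨x, rfl⟩ : ∃ x, towerE L M k x = x' := ⟨(towerE L M k).symm x', Equiv.apply_symm_apply _ _⟩
  rw [trS_apply, towerE_eq, divS_trC (towerM_eq_fine L M k), Nat.cast_pow, B5Eq123Torus.divS_cplx, ← Dv_eq_dvR]
  rfl

/-- **`Δ` = `Δ`**: `Lap k λ` read on `T_η` is the tree's `LapS·λ̃`. [cite: Balaban1984PropagatorsI, (1.21) p.21, (1.20) p.20] -/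
theorem LapS_towerE (k : ℕ) (l : Scl (towerM L M k)) :
    LapS (fine (L ^ k) M) ((L ^ k : ℕ) : ℂ) *ᵥ trS (towerE L M k) (cplxS l) = trS (towerE L M k) (cplxS (Lap L M k l)) := by
  funext x'
  obtain ⟨x, rfl⟩ : ∃ x, towerE L M k x = x' := ⟨(towerE L M k).symm x', Equiv.apply_symm_apply _ _⟩
  rw [trS_apply, towerE_eq, LapS_trS (towerM_eq_fine L M k), Nat.cast_pow, B5Eq123Torus.LapS_cplxS, ← Lap_eq_LapR]
  rfl

/-- **`N(Q′_k)` = `N(Q′_k)`**: `Q′_k λ̃ = 0` on `T_η` iff `Qsk k λ = 0` on the tower. [cite: Balaban1984PropagatorsI, (1.20) p.20] -/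
theorem QsOp_trS_eq_zero_iff (k : ℕ) (l : Scl (towerM L M k)) :
    QsOp (L ^ k) M *ᵥ trS (towerE L M k) (cplxS l) = 0 ↔ Qsk L M k l = 0 := by
  rw [← cplxS_Qsk]
  constructor
  · intro h
    ext y
    have hy := congrFun h y
    simpa [cplxS] using hy
  · intro h
    rw [h]
    funext y
    simp [cplxS]

/-- **the pairing `⟨∂*A, Δλ⟩`** of the Landau condition (`B5Eq147Landau.mem_Lan_iff_inner`) is the Hermitian pairing
`⟨Δλ̃, ∂*Ã⟩` of `L²(T_η)`. [cite: Balaban1984PropagatorsI, p.25, (1.21) p.21] -/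
theorem inner_Dv_Lap_eq (k : ℕ) (A : Fld (towerM L M k)) (l : Scl (towerM L M k)) :
    ((⟪Dv L M k A, Lap L M k l⟫_ℝ : ℝ) : ℂ) =
      star (LapS (fine (L ^ k) M) ((L ^ k : ℕ) : ℂ) *ᵥ trS (towerE L M k) (cplxS l)) ⬝ᵥ
        divS (fine (L ^ k) M) ((L ^ k : ℕ) : ℂ) (trC (towerE L M k) (cplx A)) := by
  rw [LapS_towerE, divS_towerE, star_trS_dotProduct_trS, star_cplxS_dotProduct_cplxS,
    real_inner_comm (Dv L M k A) (Lap L M k l)]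

/-- the real part of `λ ∈ L²(T_η)` pulled back to the tower. [cite: Balaban1984PropagatorsI, (1.20) p.20] -/
def reS (k : ℕ) (lam : Tor (fine (L ^ k) M) → ℂ) : Scl (towerM L M k) :=
  WithLp.toLp 2 fun x => (lam (towerE L M k x)).re

/-- the imaginary part of `λ ∈ L²(T_η)` pulled back to the tower. [cite: Balaban1984PropagatorsI, (1.20) p.20] -/
def imS (k : ℕ) (lam : Tor (fine (L ^ k) M) → ℂ) : Scl (towerM L M k) :=
  WithLp.toLp 2 fun x => (lam (towerE L M k x)).im

omit [NeZero L] hM in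
/-- `reS` read on `T_η` is `Re λ`. [cite: Balaban1984PropagatorsI, (1.20) p.20] -/
theorem trS_reS (k : ℕ) (lam : Tor (fine (L ^ k) M) → ℂ) : trS (towerE L M k) (cplxS (reS L M k lam)) = reC lam := by
  funext x'
  rw [trS_apply', reC_apply, reS]
  simp only [cplxS, Equiv.apply_symm_apply]

omit [NeZero L] hM in
/-- `imS` read on `T_η` is `Im λ`. [cite: Balaban1984PropagatorsI, (1.20) p.20] -/
theorem trS_imS (k : ℕ) (lam : Tor (fine (L ^ k) M) → ℂ) : trS (towerE L M k) (cplxS (imS L M k lam)) = imC lam := by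
  funext x'
  rw [trS_apply', imC_apply, imS]
  simp only [cplxS, Equiv.apply_symm_apply]

/-! ## §3  The p. 25 projection `R` (`B5Identities197Torus.RT`) against divergences -/

section RT

variable (n : ℕ) [NeZero n]

/-- moving `R` across the Hermitian pairing («orthogonal»: `Rᴴ = R`). [cite: Balaban1984PropagatorsI, p.25] -/
theorem star_dotProduct_RT_mulVec (v g : Tor (fine n M) → ℂ) :
    star v ⬝ᵥ (RT n M *ᵥ g) = star (RT n M *ᵥ v) ⬝ᵥ g := by
  rw [Matrix.dotProduct_mulVec, Matrix.star_mulVec, RT_conjTranspose]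

/-- `R∂*Y = (I − P)∂*Y` — the p. 25 projection and the formula (1.38)/(1.69) agree in front of a divergence
(`B5Identities197Torus.RT_mul_GradOp_adjoint`, vector form). [cite: Balaban1984PropagatorsI, (1.38) p.24, (1.69) p.29, p.25] -/
theorem RT_mulVec_divS (Y : Tor (fine n M) × Fin d → ℂ) :
    RT n M *ᵥ divS (fine n M) (n : ℂ) Y = (1 - PcT n M (n : ℂ)) *ᵥ divS (fine n M) (n : ℂ) Y := by
  rw [← GradOp_conjTranspose_mulVec_eq, Matrix.mulVec_mulVec, RT_mul_GradOp_adjoint, ← Matrix.mulVec_mulVec]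

/-- for `λ ∈ N(Q′_k)`: `⟨Δλ, ∂*Y⟩ = ⟨Δλ, (I − P)∂*Y⟩` («RΔλ = Δλ if Q′_kλ = 0», p. 25).
[cite: Balaban1984PropagatorsI, p.25, (1.38) p.24] -/
theorem star_LapS_dotProduct_divS {lam : Tor (fine n M) → ℂ} (hlam : QsOp n M *ᵥ lam = 0)
    (Y : Tor (fine n M) × Fin d → ℂ) :
    star (LapS (fine n M) (n : ℂ) *ᵥ lam) ⬝ᵥ divS (fine n M) (n : ℂ) Y =
      star (LapS (fine n M) (n : ℂ) *ᵥ lam) ⬝ᵥ ((1 - PcT n M (n : ℂ)) *ᵥ divS (fine n M) (n : ℂ) Y) := by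
  rw [← RT_mulVec_divS, star_dotProduct_RT_mulVec, RT_mulVec_LapS_of_ker n M lam hlam]

end RT

/-! ## §4  DICTIONARY: `B5Eq147Landau.Lan k` («R∂*A = 0», `R` = orthogonal projection onto `ΔN(Q′_k)`) is the tree's
gauge condition `(I − P)∂*Ã = 0` -/

/-- **sufficiency**: the tree's gauge condition `(1 − PcT)∂*Ã = 0` puts the tower field in the Landau subspace `Lan k`.
[cite: Balaban1984PropagatorsI, p.25, (1.38) p.24, (1.69) p.29] -/
theorem mem_Lan_of_oneSubPcT (k : ℕ) (A : Fld (towerM L M k))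
    (h : (1 - PcT (L ^ k) M ((L ^ k : ℕ) : ℂ)) *ᵥ
      divS (fine (L ^ k) M) ((L ^ k : ℕ) : ℂ) (trC (towerE L M k) (cplx A)) = 0) :
    A ∈ Lan L M k := by
  rw [mem_Lan_iff_inner]
  intro l hl
  apply Complex.ofReal_injective
  rw [inner_Dv_Lap_eq, star_LapS_dotProduct_divS M (L ^ k) ((QsOp_trS_eq_zero_iff L M k l).2 hl), h,
    dotProduct_zero, Complex.ofReal_zero]

/-- **necessity, pairing form**: for `A ∈ Lan k`, `⟨Δλ, ∂*Ã⟩ = 0` for every COMPLEX `λ ∈ N(Q′_k)` (real and imaginary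
parts separately). [cite: Balaban1984PropagatorsI, p.25] -/
theorem star_LapS_dotProduct_divS_eq_zero_of_mem_Lan (k : ℕ) {A : Fld (towerM L M k)} (hA : A ∈ Lan L M k)
    {lam : Tor (fine (L ^ k) M) → ℂ} (hlam : QsOp (L ^ k) M *ᵥ lam = 0) :
    star (LapS (fine (L ^ k) M) ((L ^ k : ℕ) : ℂ) *ᵥ lam) ⬝ᵥ
      divS (fine (L ^ k) M) ((L ^ k : ℕ) : ℂ) (trC (towerE L M k) (cplx A)) = 0 := by
  rw [mem_Lan_iff_inner] at hA
  have hre : Qsk L M k (reS L M k lam) = 0 := by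
    rw [← QsOp_trS_eq_zero_iff, trS_reS, QsOp_mulVec_reC, hlam]
    funext x
    simp [reC_apply]
  have him : Qsk L M k (imS L M k lam) = 0 := by
    rw [← QsOp_trS_eq_zero_iff, trS_imS, QsOp_mulVec_imC, hlam]
    funext x
    simp [imC_apply]
  have h1 : ((⟪Dv L M k A, Lap L M k (reS L M k lam)⟫_ℝ : ℝ) : ℂ) = 0 := by
    rw [hA _ hre, Complex.ofReal_zero]
  have h2 : ((⟪Dv L M k A, Lap L M k (imS L M k lam)⟫_ℝ : ℝ) : ℂ) = 0 := by
    rw [hA _ him, Complex.ofReal_zero]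
  rw [inner_Dv_Lap_eq, trS_reS] at h1
  rw [inner_Dv_Lap_eq, trS_imS] at h2
  have hsplit : lam = reC lam + Complex.I • imC lam := (reC_add_imC lam).symm
  rw [hsplit, Matrix.mulVec_add, Matrix.mulVec_smul, star_add, star_smul, add_dotProduct, smul_dotProduct, h1, h2,
    smul_zero, add_zero]

/-- **necessity**: for `A ∈ Lan k`, `R∂*Ã = 0` with the p. 25 projection `R = RT`. [cite: Balaban1984PropagatorsI, p.25] -/
theorem RT_divS_eq_zero_of_mem_Lan (k : ℕ) {A : Fld (towerM L M k)} (hA : A ∈ Lan L M k) :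
    RT (L ^ k) M *ᵥ divS (fine (L ^ k) M) ((L ^ k : ℕ) : ℂ) (trC (towerE L M k) (cplx A)) = 0 := by
  set g := divS (fine (L ^ k) M) ((L ^ k : ℕ) : ℂ) (trC (towerE L M k) (cplx A)) with hg
  obtain ⟨μ, hμ, hw⟩ := RT_mulVec_eq_LapS (L ^ k) M g
  have h0 : star (RT (L ^ k) M *ᵥ g) ⬝ᵥ (RT (L ^ k) M *ᵥ g) = 0 := by
    calc star (RT (L ^ k) M *ᵥ g) ⬝ᵥ (RT (L ^ k) M *ᵥ g)
        = star (LapS (fine (L ^ k) M) ((L ^ k : ℕ) : ℂ) *ᵥ μ) ⬝ᵥ (RT (L ^ k) M *ᵥ g) := by rw [hw]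
      _ = star (RT (L ^ k) M *ᵥ (LapS (fine (L ^ k) M) ((L ^ k : ℕ) : ℂ) *ᵥ μ)) ⬝ᵥ g :=
          star_dotProduct_RT_mulVec M (L ^ k) _ _
      _ = star (LapS (fine (L ^ k) M) ((L ^ k : ℕ) : ℂ) *ᵥ μ) ⬝ᵥ g := by
          rw [RT_mulVec_LapS_of_ker (L ^ k) M μ hμ]
      _ = 0 := by rw [hg]; exact star_LapS_dotProduct_divS_eq_zero_of_mem_Lan L M k hA hμ
  exact dotProduct_star_self_eq_zero.mp h0

/-- **DICTIONARY, `R = RT`**: `A ∈ Lan k ↔ R∂*Ã = 0` for the p. 25 projection `R` of `B5Identities197Torus`.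
[cite: Balaban1984PropagatorsI, p.25 «R … is an orthogonal projection on the linear subspace ΔN(Q′_k)»] -/
theorem mem_Lan_iff_RT (k : ℕ) (A : Fld (towerM L M k)) :
    A ∈ Lan L M k ↔ RT (L ^ k) M *ᵥ divS (fine (L ^ k) M) ((L ^ k : ℕ) : ℂ) (trC (towerE L M k) (cplx A)) = 0 :=
  ⟨RT_divS_eq_zero_of_mem_Lan L M k, fun h =>
    mem_Lan_of_oneSubPcT L M k A (by rwa [RT_mulVec_divS] at h)⟩

/-- **DICTIONARY, `R = I − P`**: `A ∈ Lan k ↔ (1 − PcT (L^k) M)·∂*Ã = 0` — the Landau subspace of `B5Eq147Landau` (p. 25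
reading of `R`) is the tree's gauge condition with the formula (1.38)/(1.69)–(1.70) for `R = I − P` (the condition under
which `B5Hk163RDiv`, `B5Hk164Transl`, `B5HkPropsTorus` work). [cite: Balaban1984PropagatorsI, (1.38) p.24, p.25, (1.69) p.29] -/
theorem mem_Lan_iff_oneSubPcT (k : ℕ) (A : Fld (towerM L M k)) :
    A ∈ Lan L M k ↔ (1 - PcT (L ^ k) M ((L ^ k : ℕ) : ℂ)) *ᵥ
      divS (fine (L ^ k) M) ((L ^ k : ℕ) : ℂ) (trC (towerE L M k) (cplx A)) = 0 := by
  rw [mem_Lan_iff_RT, RT_mulVec_divS]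

/-! ## §5  The (1.63) operator `H_k`, transported to the tower, is the Landau minimiser `H_kB` -/

/-- **`H_kB` on the tower from the closed form (1.63)**: the pull-back (real part, `B5TowerOneStroke.pullR`) of
`B5Hk163Torus.HkOp (L^k) M · cplx B`. [cite: Balaban1984PropagatorsI, (1.63) p.28 «This defines the operator H_kB = A»] -/
def hkT (k : ℕ) (B : Fld M) : Fld (towerM L M k) :=
  pullR L M k (HkOp (L ^ k) M *ᵥ cplx B)

/-- unfolding. [cite: Balaban1984PropagatorsI, (1.63) p.28] -/
theorem hkT_def (k : ℕ) (B : Fld M) : hkT L M k B = pullR L M k (HkOp (L ^ k) M *ᵥ cplx B) := rfl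

/-- «Q_kH_kB = B» on the tower (seat p21's `Qk_pullR_HkOp`). [cite: Balaban1984PropagatorsI, p.29 «Q_kH_kB = B»] -/
theorem Qk_hkT (k : ℕ) (B : Fld M) : Qk L M k (hkT L M k B) = B :=
  Qk_pullR_HkOp L M k B

/-- **«R∂*H_kB = 0» on the tower**: the transported (1.63) field lies in the Landau subspace `Lan k` of
`B5Eq147Landau` — from the tree's `B5Hk163RDiv.R_divS_HkOp'` through the §3 pairing and real parts.
[cite: Balaban1984PropagatorsI, p.29 «R∂*H_kB = 0», p.25] -/
theorem hkT_mem_Lan (k : ℕ) (B : Fld M) : hkT L M k B ∈ Lan L M k := by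
  rw [mem_Lan_iff_inner]
  intro l hl
  apply Complex.ofReal_injective
  rw [inner_Dv_Lap_eq, hkT_def, trC_cplx_pullR, divS_reC, LapS_towerE, star_trS_cplxS_dotProduct_reC, ← LapS_towerE,
    star_LapS_dotProduct_divS M (L ^ k) ((QsOp_trS_eq_zero_iff L M k l).2 hl), R_divS_HkOp', dotProduct_zero,
    Complex.zero_re, Complex.ofReal_zero]

/-- `H_kB` lies on the hyperplane `{A : Q_kA = B, R∂*A = 0}`. [cite: Balaban1984PropagatorsI, p.29, p.26] -/
theorem hkT_mem_fibre (k : ℕ) (B : Fld M) : hkT L M k B ∈ fibre (Qk L M k) (Lan L M k) B :=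
  ⟨Qk_hkT L M k B, hkT_mem_Lan L M k B⟩

/-- **«H_kB is a minimum of ½⟨∂A, ∂A⟩ on the hyperplane {A : Q_kA = B, R∂*A = 0}»**: the transported (1.63) field is a
Landau minimiser in the sense of `B5Eq165DeltaK.landauMin` (every `d`; minimality from seat p21's
`actionEta_pullR_HkOp`/`half_formDk_le_actionEta`). [cite: Balaban1984PropagatorsI, p.29, p.26 «minimizing … under the
conditions Q_kA = B, R∂*A = 0»] -/
theorem hkT_mem_landauMin (k : ℕ) (B : Fld M) : hkT L M k B ∈ landauMin L M k B := by
  refine ⟨hkT_mem_fibre L M k B, fun A' hA' => ?_⟩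
  rw [hkT_def, actionEta_pullR_HkOp]
  exact half_formDk_le_actionEta L M k B A' hA'.1

/-- **`H_k` of (1.63) = the Landau minimiser** (`d ≥ 2`): every element of `landauMin k B` is the transported (1.63)
field. [cite: Balaban1984PropagatorsI, (1.63) p.28 «This defines the operator H_kB = A», p.29] -/
theorem eq_hkT_of_mem_landauMin (hd : 2 ≤ d) (k : ℕ) {B : Fld M} {A : Fld (towerM L M k)}
    (hA : A ∈ landauMin L M k B) : A = hkT L M k B :=
  landauMin_subsingleton L M hd k B hA (hkT_mem_landauMin L M k B)

/-- **`landauMin k B = {H_kB}`** with the tree's closed-form `H_k` (`d ≥ 2`).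
[cite: Balaban1984PropagatorsI, (1.63) p.28, p.29] -/
theorem landauMin_eq_singleton (hd : 2 ≤ d) (k : ℕ) (B : Fld M) : landauMin L M k B = {hkT L M k B} :=
  Set.eq_singleton_iff_unique_mem.2
    ⟨hkT_mem_landauMin L M k B, fun _ hA => eq_hkT_of_mem_landauMin L M hd k hA⟩

/-- `½⟨B, Δ_kB⟩ = S^η(H_kB)` for the Δ_k of (1.19) (`B5Eq114Gauss.DeltaK`) and the tree's `H_k` — every `d` — obtained
here from `landauMin` membership (`B5Eq165DeltaK.actionEta_of_mem_landauMin`).  (With seat p21's `actionEta_pullR_HkOp` the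
right side is `½·formDk (L^k) M (cplx B)`; that form, and this number by the IsLeast.unique road, are
`B5Eq166GaussDeltaK`, p249024.) [cite: Balaban1984PropagatorsI, (1.64)–(1.65) p.29] -/
theorem S1_DeltaK_eq_actionEta_hkT (k : ℕ) (B : Fld M) :
    S1 M (DeltaK L M k) B = actionEta L M k (hkT L M k B) :=
  (actionEta_of_mem_landauMin L M k (hkT_mem_landauMin L M k B)).symm

/-- **(1.65) with the tree's `H_k`**: `⟨B, Δ_kB⟩ = 2·S^η(H_kB)` («= ⟨∂H_kB, ∂H_kB⟩» with the (1.21) weight), Δ_k of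
(1.19). [cite: Balaban1984PropagatorsI, (1.65) p.29] -/
theorem eq165_hkT (k : ℕ) (B : Fld M) : ⟪B, DeltaK L M k B⟫_ℝ = 2 * actionEta L M k (hkT L M k B) :=
  eq165 L M k (hkT_mem_landauMin L M k B)

/-- **(1.64) with the tree's `H_k`** (`d ≥ 2`): `((ST)^k e^{−S})(B) = Z·exp(−S^η(H_kB))`.
[cite: Balaban1984PropagatorsI, (1.64) p.29] -/
theorem eq164_hkT (hd : 2 ≤ d) (k : ℕ) :
    ∃ Z : ℝ, 0 < Z ∧ ∀ B : Fld M,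
      iterST L M k (fun A => Real.exp (-action1 A)) B = Z * Real.exp (-actionEta L M k (hkT L M k B)) := by
  obtain ⟨Z, hZ, h⟩ := eq164 L M hd k
  exact ⟨Z, hZ, fun B => h B _ (hkT_mem_landauMin L M k B)⟩

/-- **«which means that ⟨∂A′, ∂H_kB⟩ = 0 on the subspace {A′ : Q_kA′ = 0, R∂*A′ = 0}»** for the tree's `H_k` on the
tower (`∂ ↦ σ^k𝒯 = Tk`). [cite: Balaban1984PropagatorsI, p.29] -/
theorem inner_Tk_hkT_eq_zero (k : ℕ) (B : Fld M) {v : Fld (towerM L M k)}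
    (hv : v ∈ dirSpace (Qk L M k) (Lan L M k)) : ⟪Tk L M k (hkT L M k B), Tk L M k v⟫_ℝ = 0 :=
  inner_Tk_eq_zero_of_mem_landauMin L M k (hkT_mem_landauMin L M k B) hv

/-! ## §6  Row B5.Claim@29 in the currency of the (1.17) tower: `B5.HkPropsPrinted` -/

/-- the tower data for the typed sentence `B5.HkPropsPrinted`: fields on `towerM L M k`, coarse fields on `M`,
`Q := Q_k` (composite averaging of the tower), `gauge := (R∂*· = 0)` as `· ∈ Lan k`, `energy := S^η_k` (1.21),
`H := H_k` of (1.63) transported. [cite: Balaban1984PropagatorsI, p.29, (1.17) p.20, (1.21) p.21, (1.63) p.28] -/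
def hkDataTower (k : ℕ) : HkData where
  CfgA := Fld (towerM L M k)
  CfgB := Fld M
  Q := fun A => Qk L M k A
  gauge := fun A => A ∈ Lan L M k
  energy := actionEta L M k
  H := hkT L M k

/-- **B5.Claim@29 HOLDS on the (1.17) tower** (every `d`, `L ≥ 1`, `M`, `k`): «Q_kH_kB = B, R∂*H_kB = 0, H_kB is a
minimum of ½⟨∂A, ∂A⟩ on the hyperplane {A : Q_kA = B, R∂*A = 0}» for the data `hkDataTower`.
[cite: Balaban1984PropagatorsI, p.29 after (1.63)] -/
theorem hkPropsPrinted_tower (k : ℕ) : HkPropsPrinted (hkDataTower L M k) := by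
  intro B
  refine ⟨Qk_hkT L M k B, hkT_mem_Lan L M k B, fun A hQ _ => ?_⟩
  show actionEta L M k (hkT L M k B) ≤ actionEta L M k A
  rw [hkT_def, actionEta_pullR_HkOp]
  exact half_formDk_le_actionEta L M k B A hQ

/-- **the printed properties DETERMINE `H_k` on the tower** (`d ≥ 2`): any candidate `H′` for which the tower data satisfy
`B5.HkPropsPrinted` is the transported (1.63) operator. [cite: Balaban1984PropagatorsI, p.28 «This defines the operator
H_kB = A», p.29] -/
theorem eq_hkT_of_hkPropsPrinted (hd : 2 ≤ d) (k : ℕ) {H' : Fld M → Fld (towerM L M k)}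
    (h : HkPropsPrinted { hkDataTower L M k with H := H' }) (B : Fld M) : H' B = hkT L M k B := by
  obtain ⟨hQ, hG, hmin⟩ := h B
  exact eq_hkT_of_mem_landauMin L M hd k ⟨⟨hQ, hG⟩, fun A' hA' => hmin A' hA'.1 hA'.2⟩

/-- `B5.HkPropsPrinted` for the tower data with candidate `H′` ⟺ `H′ = H_k` (`d ≥ 2`).
[cite: Balaban1984PropagatorsI, p.28, p.29] -/
theorem hkPropsPrinted_tower_iff (hd : 2 ≤ d) (k : ℕ) {H' : Fld M → Fld (towerM L M k)} :
    HkPropsPrinted { hkDataTower L M k with H := H' } ↔ ∀ B, H' B = hkT L M k B := by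
  refine ⟨fun h B => eq_hkT_of_hkPropsPrinted L M hd k h B, fun h => ?_⟩
  obtain rfl : H' = hkT L M k := funext h
  exact hkPropsPrinted_tower L M k

end

end Literature.MathematicalPhysics.QuantumFieldTheory.Balaban1983to89.B5HkOpLandauMin
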